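import Summits.QuantumFields.BalabanUV.T4Continuum.Spine.NE2BalabanStations
import Summits.QuantumFields.BalabanUV.T4Continuum.Spine.NE2ColourPerturbedLayerRate
import Summits.QuantumFields.BalabanUV.T4Continuum.Support.DecayRateInterpolation

/-!
# T⁴ programme, spine node NE2 (U1a), sub-row Δ3 «NE2-WALK» (T4-DAG `T4-U1a.S-NE2-D3-WALK°`) — THE DECAY STATIONS OF THE COLOUR
# TOWER AND OF ROOT B: King's (4.38) shape (entrywise η-rate WITH exponential off-diagonal decay) for `pertCovC` / `pertLimC`,
# from the landed operator-norm rate and ONE displayed level-uniform decay binder `hdec`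

Eleventh generation of the NE2 prover lineage P1 of the cell `pub-balaban` (row NE2 owner), file 2; companion of
`Support/DecayRateInterpolation` (p218010/p218145: operator-norm rate ∧ level-uniform entry decay ⟹ King's shape with the rate
exponent and the decay rate halved).  Here that conversion is put ON THE NAMED OBJECTS of tier B:

 * §1 **`decayStations_pertCovC_rate`** — for ANY perturbation family `P` of the lifted free tower with
   `PerturbationLaws (Δ_a⊗1) P (J⊗1) κ (k ↦ C₂ρ^k)`, `L⁻¹ ≤ ρ < 1`, any coupling `‖t‖κ < 1`, and ANY «distance» `dist` on the unit
   lattice `idx L M 0 × o`: IF the unit-lattice covariances `pertCovC P t k` have level-uniform entry decay `(B, δ)` (binder `hdec`),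
   THEN the named limit `pertLimC P t` has entry decay `(B, δ)`, `‖(pertCovC P t k − pertLimC P t)(x,y)‖ ≤ B′·(√ρ)^k·e^{−(δ/2)dist(x,y)}`
   and `‖(pertCovC P t (k+1) − pertCovC P t k)(x,y)‖ ≤ B″·(√ρ)^k·e^{−(δ/2)dist(x,y)}` with `B′ = √(2B·Cpert(t)/(1−ρ))`, `B″ = √(2B·2Cpert(t)/(1−ρ))`
   (the general-rate engine `NE2ColourPerturbedLayerRate.towerLimitRate_perturbed_king_kron_rate`, row B8); **`decayStations_pertCovC`** —
   the same at the rate of record `ρ = L⁻¹` for the rate-`L⁻¹` laws every tier-A/B row lands (`NE2ColourPerturbedLayer.tendsto_pertLimC`).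
 * §2 **`balaban_final_decayStations_of_regular`** — ROOT B's decay stations: the displayed binders of the END of record
   (`hreg`, `hNE3`, `0 < a′`, `α ≤ η`, `β ≤ η`, `η ≤ etaStar o d a a′`, `‖t‖ ≤ 1`) PLUS `hdec` ⟹ the three conclusions for Bałaban's typed
   operator `P_B = balabanPert (liftR Rg) (gaugeSlot …)`, by `NE2BalabanStations.balaban_final_stations_of_regular` and
   `DecayRateInterpolation.decayStations_of_rate`; **`balaban_final_twoLevelDecayRate_one`** — the physical coupling `t = 1`, two-level form
   (v1.1 DOCFIX: this header named the declaration wrongly in v1 — t4-ne2-formalise-ref pass 13; code byte-identical).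

WHAT `hdec` IS (honest).  `∀ k, EntryDecay dist (pertCovC P t k) B δ`: the level-UNIFORM exponential decay of the King-averaged unit-lattice
covariances of `(Δ_a^{(k)}⊗1 + tP_k)⁻¹` — the KIND of bound the audited series prints η-uniformly for Bałaban's own propagators
([Balaban1984PropagatorsI] (1.90) p. 33 at `U = 1`; [Balaban1985BackgroundPropagators] Thm 3.4 p. 400, Thm 3.15 (3.187) p. 432 with a
background; King (4.34) p. 674 at `A = 0`, in the tree for King's scalar operators as `King1986/UniformDecay`).  It is DISPLAYED, asserted
by nobody here; for the typed model operator `P_B` it is NOT in the tree (at `U ≠ 1` it would be read on Bałaban's carriers — dictionary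
B0, asserted by no tier-B file), and at `U = 1` for Bałaban's vector `𝒢` the η-uniform TORUS decay of the unit-lattice images is not yet
assembled in the tree either (`B5G183FreeDecay` HONEST SCOPE (v)).  So this file LOCATES sub-row Δ3: the decay currency of U1a ⇐ ROOT B
(landed, conditional on NE3 + the (3.35)-class + the threshold) ∧ ONE printed-kind uniform decay input — no weighted two-level law is
needed; cost: rate `√(L⁻¹)` instead of `L⁻¹` and decay `δ/2` instead of `δ` (every geometric-rate consumer of the spine — node U3, row B8 —
is indifferent).  Dictionary to the typed consumer shape: `DecayRate`/`TwoLevelDecayRate dist c … B′ (δ/2) (√ρ)` IS the display of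
`T4EtaRate.EtaRateIneqUnit` with `(B₀, δ₀, θ) = (B′, δ/2, √ρ)` and `unitDist = dist` (that module's carriers are abstract; no import).

HONEST FRAMING (T4-DAG p. 1).  Model level (no B0); finite torus, linear layer; statements and constants OURS ([folklore] bookkeeping over
landed modules — nothing printed is a hypothesis, `[cite:]` tags locate SHAPES); CONDITIONAL on node NE3's `LocalRate` BY NAME (OPEN), on
the (3.35)-shape class, on the explicit threshold AND on `hdec`; NOT [B9] (3.23)–(3.26) as printed; NE2 (U1a) is NOT proved by this file;
spine PROVED 0/9 unchanged; NOT infinite volume, NOT a mass gap, NOT the Clay problem, NOT summit progress.  HONEST DEPENDENCY: continuum YM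
on T⁴ ⇐ BetaPertH ∧ nine spine estimates (0/9 proved); BetaPertH ⇐ (D1) ∧ (D4) ∧ CAP+tail; G-an2-4 gates asym, D1 and NE2/3/4.  No `sorry`.
-/

noncomputable section

open scoped BigOperators ComplexConjugate Matrix Matrix.Norms.L2Operator Kronecker
open Filter Topology

namespace Summit.QuantumFields.BalabanUV.T4Continuum.NE2BalabanDecayRate

open Literature.MathematicalPhysics.QuantumFieldTheory.Balaban1983to89.B5Prop11Plancherel (Cst Cst_nonneg Tor fine)
open Literature.MathematicalPhysics.QuantumFieldTheory.Balaban1983to89.B5G183RateUnitTower (lev lev_neZero)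
open Literature.MathematicalPhysics.QuantumFieldTheory.Balaban1983to89.T4EtaRateMin (LocalRate)
open Summit.QuantumFields.BalabanUV.T4Continuum
open Summit.QuantumFields.BalabanUV.T4Continuum.CovariantAveragingTower (avgTow TowerLimitRate)
open Summit.QuantumFields.BalabanUV.T4Continuum.BalabanAveragedTowerUnit (idx Qlev)
open Summit.QuantumFields.BalabanUV.T4Continuum.BackgroundResolventTower
open Summit.QuantumFields.BalabanUV.T4Continuum.KingPairingPlantedLaw
open Summit.QuantumFields.BalabanUV.T4Continuum.GramPerturbationLaw (C2gram)
open Summit.QuantumFields.BalabanUV.T4Continuum.NE2FromNE3 (bgReadings)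
open Summit.QuantumFields.BalabanUV.T4Continuum.NE2ColourPerturbedLayer (pertCovC pertLimC tendsto_pertLimC)
open Summit.QuantumFields.BalabanUV.T4Continuum.NE2ColourPerturbedLayerRate (towerLimitRate_perturbed_king_kron_rate)
open Summit.QuantumFields.BalabanUV.T4Continuum.RegularBackgroundTower (RegularTransporters regClass betaNE3)
open Summit.QuantumFields.BalabanUV.T4Continuum.GaugeTermScalarData (QuT Q1)
open Summit.QuantumFields.BalabanUV.T4Continuum.RegularSiteTransporters (siteT)
open Summit.QuantumFields.BalabanUV.T4Continuum.NestedContourTransport (theta0)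
open Summit.QuantumFields.BalabanUV.T4Continuum.NE2BalabanRoot (balabanPert)
open Summit.QuantumFields.BalabanUV.T4Continuum.NE2BalabanGauge (gaugeSlot liftR)
open Summit.QuantumFields.BalabanUV.T4Continuum.NE2BalabanLayerSharp (kappaBs C2Bs)
open Summit.QuantumFields.BalabanUV.T4Continuum.NE2BalabanWiring (epsR CdeltaR)
open Summit.QuantumFields.BalabanUV.T4Continuum.NE2BalabanFinal (kappa4F C4F)
open Summit.QuantumFields.BalabanUV.T4Continuum.NE2BalabanThreshold (etaStar)
open Summit.QuantumFields.BalabanUV.T4Continuum.NE2BalabanStations (balaban_final_stations_of_regular)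
open Summit.QuantumFields.BalabanUV.T4Continuum.DecayRateInterpolation (EntryDecay DecayRate TwoLevelDecayRate decayStations_of_rate)

variable {d : ℕ} (L : ℕ) [NeZero L] (M : Fin d → ℕ) [hM : ∀ μ, NeZero (M μ)] (a : ℝ) (ha : 0 < a)
variable {o : Type*} [Fintype o] [DecidableEq o]

omit [NeZero L] in
/-- `0 ≤ L⁻¹`. [folklore] -/
theorem invL_nonneg : (0 : ℝ) ≤ (L : ℝ)⁻¹ := inv_nonneg.mpr (Nat.cast_nonneg L)

omit [NeZero L] in
/-- `L⁻¹ < 1` for `L ≥ 2`. [folklore] -/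
theorem invL_lt_one (hL : 2 ≤ L) : ((L : ℝ)⁻¹) < 1 :=
  inv_lt_one_of_one_lt₀ (by exact_mod_cast (lt_of_lt_of_le one_lt_two hL : 1 < L))

/-! ## §1 The decay stations of the colour tower for any perturbation family -/

/-- **DECAY STATIONS AT A GENERAL RATE** (`L⁻¹ ≤ ρ < 1`): for every perturbation family `P` with `PerturbationLaws (Δ_a⊗1) P (J⊗1) κ (k ↦ C₂ρ^k)`,
every coupling `‖t‖κ < 1`, every «distance» `dist` on the unit lattice and every level-UNIFORM entry decay `hdec : ∀ k, ‖(pertCovC P t k)(x,y)‖ ≤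
B·e^{−δ·dist(x,y)}`: the tower converges to the named limit `pertLimC P t`, the limit has entry decay `(B, δ)`, and King's (4.38) shape holds
towards the limit with `(√(2B·Cpert(t)/(1−ρ)), δ/2, √ρ)` and between consecutive levels with `(√(2B·2Cpert(t)/(1−ρ)), δ/2, √ρ)`,
`Cpert(t) = Cpert κ (2dCst) CJ C₂ 0 t`.  Statement OURS; `hdec` displayed, asserted by nobody.
[cite: King1986, Lemma 4.5 (4.38) p.674 (shape); Balaban1985BackgroundPropagators, Thm 3.4 p.400 (the printed kind of `hdec`)] [folklore] -/
theorem decayStations_pertCovC_rate {ρ : ℝ} (hρ : ((L : ℝ)⁻¹) ≤ ρ) (hρ1 : ρ < 1)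
    {P : (k : ℕ) → Matrix (idx L M k × o) (idx L M k × o) ℂ} {κ C₂ : ℝ}
    (hpert : PerturbationLaws (fun k => calDalev L M a ha k ⊗ₖ (1 : Matrix o o ℂ)) P (fun k => JpcT L M k ⊗ₖ (1 : Matrix o o ℂ)) κ
      (fun k => C₂ * ρ ^ k)) {t : ℂ} (ht : ‖t‖ * κ < 1)
    {dist : idx L M 0 × o → idx L M 0 × o → ℝ} {B δ : ℝ} (hdec : ∀ k, EntryDecay dist (pertCovC L M a ha P t k) B δ) :
    Tendsto (pertCovC L M a ha P t) atTop (𝓝 (pertLimC L M a ha P t)) ∧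
      EntryDecay dist (pertLimC L M a ha P t) B δ ∧
      DecayRate dist (pertCovC L M a ha P t) (pertLimC L M a ha P t)
        (Real.sqrt (2 * B * (Cpert κ (2 * d * Cst d a) (CJ d a) C₂ 0 t / (1 - ρ)))) (δ / 2) (Real.sqrt ρ) ∧
      TwoLevelDecayRate dist (pertCovC L M a ha P t)
        (Real.sqrt (2 * B * (2 * Cpert κ (2 * d * Cst d a) (CJ d a) C₂ 0 t / (1 - ρ)))) (δ / 2) (Real.sqrt ρ) := by
  obtain ⟨c, hc, hrate⟩ := towerLimitRate_perturbed_king_kron_rate L M a ha hρ hρ1 hpert ht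
  have hc' : Tendsto (pertCovC L M a ha P t) atTop (𝓝 c) := hc
  have hlim : Tendsto (pertCovC L M a ha P t) atTop (𝓝 (pertLimC L M a ha P t)) := tendsto_nhds_limUnder ⟨c, hc'⟩
  have heq : pertLimC L M a ha P t = c := tendsto_nhds_unique hlim hc'
  have hrate' : ∀ k, ‖pertCovC L M a ha P t k - pertLimC L M a ha P t‖
      ≤ Cpert κ (2 * d * Cst d a) (CJ d a) C₂ 0 t * ρ ^ k / (1 - ρ) := fun k => by
    rw [heq]; exact hrate k
  exact ⟨hlim, decayStations_of_rate ((invL_nonneg L).trans hρ) hρ1 hlim hrate' hdec⟩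

/-- **DECAY STATIONS AT THE RATE OF RECORD `L⁻¹`** (`L ≥ 2`) for the rate-`L⁻¹` laws every tier-A / tier-B row lands
(`PerturbationLaws … κ (k ↦ C₂L^{−k})`), every `‖t‖κ < 1`, every `dist` and every level-uniform decay binder `hdec`: limit decay `(B, δ)`,
King's shape towards `pertLimC P t` with `(√(2B·Cpert(t)/(1−L⁻¹)), δ/2, √(L⁻¹))` and the two-level shape with `(√(2B·2Cpert(t)/(1−L⁻¹)), δ/2, √(L⁻¹))`.
[cite: King1986, Lemma 4.5 (4.38) p.674 (shape)] [folklore] -/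
theorem decayStations_pertCovC (hL : 2 ≤ L) {P : (k : ℕ) → Matrix (idx L M k × o) (idx L M k × o) ℂ} {κ C₂ : ℝ}
    (hpert : PerturbationLaws (fun k => calDalev L M a ha k ⊗ₖ (1 : Matrix o o ℂ)) P (fun k => JpcT L M k ⊗ₖ (1 : Matrix o o ℂ)) κ
      (fun k => C₂ * ((L : ℝ)⁻¹) ^ k)) {t : ℂ} (ht : ‖t‖ * κ < 1)
    {dist : idx L M 0 × o → idx L M 0 × o → ℝ} {B δ : ℝ} (hdec : ∀ k, EntryDecay dist (pertCovC L M a ha P t k) B δ) :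
    EntryDecay dist (pertLimC L M a ha P t) B δ ∧
      DecayRate dist (pertCovC L M a ha P t) (pertLimC L M a ha P t)
        (Real.sqrt (2 * B * (Cpert κ (2 * d * Cst d a) (CJ d a) C₂ 0 t / (1 - (L : ℝ)⁻¹)))) (δ / 2) (Real.sqrt ((L : ℝ)⁻¹)) ∧
      TwoLevelDecayRate dist (pertCovC L M a ha P t)
        (Real.sqrt (2 * B * (2 * Cpert κ (2 * d * Cst d a) (CJ d a) C₂ 0 t / (1 - (L : ℝ)⁻¹)))) (δ / 2) (Real.sqrt ((L : ℝ)⁻¹)) := by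
  obtain ⟨hlim, hrate⟩ := tendsto_pertLimC L M a ha hL hpert ht
  exact decayStations_of_rate (invL_nonneg L) (invL_lt_one L hL) hlim hrate hdec

/-! ## §2 ROOT B's decay stations (row B7 × sub-row Δ3) -/

/-- **ROOT B IN THE DECAY CURRENCY** (`L ≥ 2`, `d ≥ 1`, `a′ > 0`): for site-based bond transporters `Rg` in row B5's (3.35)-shape class with sizes
`α, β ≤ η ≤ η⋆(card o, d, a, a′)`, coefficient towers obeying NODE NE3's `LocalRate … C L⁻¹` (BY NAME, OPEN), a coupling `‖t‖ ≤ 1`, and a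
level-UNIFORM entry decay `hdec : ∀ k x y, ‖(pertCovC P_B t k)(x,y)‖ ≤ B·e^{−δ·dist(x,y)}` of the lifted King-averaged unit-lattice covariances of
Bałaban's typed operator `Δ_a^{(k)}⊗1 + t·P_B`, `P_B = balabanPert (liftR Rg) (gaugeSlot Rg (QuT (siteT Rg)) Q1 a′)`: the named η → 0 limit
`pertLimC P_B t` has entry decay `(B, δ)`; `‖(pertCovC P_B t k − pertLimC P_B t)(x,y)‖ ≤ √(2B·C_B(t)/(1−L⁻¹))·(√(L⁻¹))^k·e^{−(δ/2)dist(x,y)}`; and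
`‖(pertCovC P_B t (k+1) − pertCovC P_B t k)(x,y)‖ ≤ √(2B·2C_B(t)/(1−L⁻¹))·(√(L⁻¹))^k·e^{−(δ/2)dist(x,y)}` — KING's (4.38) SHAPE for ROOT B, the display
of `T4EtaRate.EtaRateIneqUnit` with `(B₀, δ₀, θ) = (·, δ/2, √(L⁻¹))`.  Displayed binders: those of `NE2BalabanThreshold.balaban_final_rate_of_regular`,
`‖t‖ ≤ 1`, `hdec` — NOTHING ELSE.  Model level (no B0); CONDITIONAL on NE3 + the (3.35)-class + the threshold + `hdec`; NE2 (U1a) is NOT proved by this.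
[cite: King1986, Lemma 4.5 (4.38) p.674 (shape); Balaban1985BackgroundPropagators, (3.26) p.395, (3.35) p.396, Thm 3.4 p.400 (shapes)] [folklore] -/
theorem balaban_final_decayStations_of_regular (hL : 2 ≤ L) (hd : 1 ≤ d)
    {Rg : (k : ℕ) → Fin d → (Tor (fine (lev L k) M) → Matrix o o ℂ)}
    {α β : ℝ} (hreg : RegularTransporters L M (liftR L M Rg) α β) {C : ℝ} (hC : 0 ≤ C)
    (hNE3 : LocalRate (bgReadings L M (regClass L M (liftR L M Rg))) C ((L : ℝ)⁻¹)) {a' : ℝ} (ha' : 0 < a')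
    {η : ℝ} (hαη : α ≤ η) (hβη : β ≤ η) (hη : η ≤ etaStar o d a a') {t : ℂ} (ht : ‖t‖ ≤ 1)
    {dist : idx L M 0 × o → idx L M 0 × o → ℝ} {B δ : ℝ}
    (hdec : ∀ k, EntryDecay dist
      (pertCovC L M a ha (balabanPert L M a (liftR L M Rg) (gaugeSlot L M Rg (QuT L M o (siteT L M Rg)) (Q1 L M o) a')) t k) B δ) :
    EntryDecay dist (pertLimC L M a ha (balabanPert L M a (liftR L M Rg) (gaugeSlot L M Rg (QuT L M o (siteT L M Rg)) (Q1 L M o) a')) t) B δ ∧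
      DecayRate dist
        (pertCovC L M a ha (balabanPert L M a (liftR L M Rg) (gaugeSlot L M Rg (QuT L M o (siteT L M Rg)) (Q1 L M o) a')) t)
        (pertLimC L M a ha (balabanPert L M a (liftR L M Rg) (gaugeSlot L M Rg (QuT L M o (siteT L M Rg)) (Q1 L M o) a')) t)
        (Real.sqrt (2 * B *
          (Cpert (kappaBs o d a α β (a * (epsR o d α * (2 + epsR o d α) * Cst d a)) (kappa4F d a a' α β)) (2 * d * Cst d a) (CJ d a)
              (C2Bs o d L a α β C
                (a * C2gram (Cst d a) 1 (epsR o d α) (2 * d * Cst d a) (CJ d a) (Cst d a) (CdeltaR o d a α (theta0 d α (betaNE3 o C))))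
                (C4F o d L a a' α β C)) 0 t / (1 - (L : ℝ)⁻¹))))
        (δ / 2) (Real.sqrt ((L : ℝ)⁻¹)) ∧
      TwoLevelDecayRate dist
        (pertCovC L M a ha (balabanPert L M a (liftR L M Rg) (gaugeSlot L M Rg (QuT L M o (siteT L M Rg)) (Q1 L M o) a')) t)
        (Real.sqrt (2 * B * (2 *
          Cpert (kappaBs o d a α β (a * (epsR o d α * (2 + epsR o d α) * Cst d a)) (kappa4F d a a' α β)) (2 * d * Cst d a) (CJ d a)
              (C2Bs o d L a α β C
                (a * C2gram (Cst d a) 1 (epsR o d α) (2 * d * Cst d a) (CJ d a) (Cst d a) (CdeltaR o d a α (theta0 d α (betaNE3 o C))))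
                (C4F o d L a a' α β C)) 0 t / (1 - (L : ℝ)⁻¹))))
        (δ / 2) (Real.sqrt ((L : ℝ)⁻¹)) := by
  obtain ⟨hlim, -, hrate, -, -⟩ := balaban_final_stations_of_regular L M a ha hL hd hreg hC hNE3 ha' hαη hβη hη ht
  exact decayStations_of_rate (invL_nonneg L) (invL_lt_one L hL) hlim hrate hdec

/-- **ROOT B IN THE DECAY CURRENCY AT THE PHYSICAL COUPLING `t = 1`, two-level form** — the literal King (4.38) / `EtaRateIneqUnit` display
`‖(c_{k+1} − c_k)(x,y)‖ ≤ B₀·θ^k·e^{−δ₀·dist(x,y)}` with `θ = √(L⁻¹) < 1`, `δ₀ = δ/2`, from the END of record's binders + `hdec`.  Model level; CONDITIONAL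
on NE3 + the (3.35)-class + the threshold + `hdec`; NE2 (U1a) NOT proved by this. [cite: King1986, Lemma 4.5 (4.38) p.674 (shape)] [folklore] -/
theorem balaban_final_twoLevelDecayRate_one (hL : 2 ≤ L) (hd : 1 ≤ d)
    {Rg : (k : ℕ) → Fin d → (Tor (fine (lev L k) M) → Matrix o o ℂ)}
    {α β : ℝ} (hreg : RegularTransporters L M (liftR L M Rg) α β) {C : ℝ} (hC : 0 ≤ C)
    (hNE3 : LocalRate (bgReadings L M (regClass L M (liftR L M Rg))) C ((L : ℝ)⁻¹)) {a' : ℝ} (ha' : 0 < a')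
    {η : ℝ} (hαη : α ≤ η) (hβη : β ≤ η) (hη : η ≤ etaStar o d a a')
    {dist : idx L M 0 × o → idx L M 0 × o → ℝ} {B δ : ℝ}
    (hdec : ∀ k, EntryDecay dist
      (pertCovC L M a ha (balabanPert L M a (liftR L M Rg) (gaugeSlot L M Rg (QuT L M o (siteT L M Rg)) (Q1 L M o) a')) 1 k) B δ) :
    ∃ B₀ : ℝ, ∀ k (x y : idx L M 0 × o),
      ‖(pertCovC L M a ha (balabanPert L M a (liftR L M Rg) (gaugeSlot L M Rg (QuT L M o (siteT L M Rg)) (Q1 L M o) a')) 1 (k + 1)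
          - pertCovC L M a ha (balabanPert L M a (liftR L M Rg) (gaugeSlot L M Rg (QuT L M o (siteT L M Rg)) (Q1 L M o) a')) 1 k) x y‖
        ≤ B₀ * Real.sqrt ((L : ℝ)⁻¹) ^ k * Real.exp (-(δ / 2 * dist x y)) := by
  have h1 : ‖(1 : ℂ)‖ ≤ 1 := by rw [norm_one]
  obtain ⟨-, -, h⟩ := balaban_final_decayStations_of_regular L M a ha hL hd hreg hC hNE3 ha' hαη hβη hη h1 hdec
  exact ⟨_, h⟩

end Summit.QuantumFields.BalabanUV.T4Continuum.NE2BalabanDecayRate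

end
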